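import Mathlib.LinearAlgebra.ExteriorPower.Basis
import Mathlib.NumberTheory.NumberField.CMField
import Mathlib.FieldTheory.IntermediateField.Adjoin.Basic
import Mathlib.Algebra.Algebra.Rat
import Mathlib.Analysis.Complex.Basic
import HarnessLib

/-!
# Gao–Ullmo 2025, §2.1 / §2.3 / §3.1: CM pairs and the combinatorial model of `H^•(A, ℂ)` of a CM abelian variety

Z. Gao, E. Ullmo, *Hodge cycles and quadratic relations between holomorphic periods on CM abelian varieties*,
J. Inst. Math. Jussieu **25** (2025), no. 1, 215–249, doi:10.1017/S1474748025101291 = arXiv:2411.12249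
[GaoUllmo2025].  This module types, verbatim from the published text, the objects over which the paper states
**Theorem 3.1 (Pohlmann)** — the description of the Hodge classes `B^p(A) ⊗ ℂ` of a CM abelian variety `A` with CM
by the CM pair `(E, Φ)` (proved in `Literature.AlgebraicGeometry.GaoUllmo2025.Theorem31`):

* §2.1 (art. p. 6–7): CM algebras (`IsCMAlgebra`), complex embeddings `Hom(E, ℂ)` (`Emb`), complex conjugation
  `φ ↦ φ̄` (`conjEmb`), CM types `Φ` with `Hom(E, ℂ) = Φ ⊔ Φ̄` (`CMTypeOn`, `CMTypeOn.bar`), the Galois closure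
  `E^c ⊂ ℂ` (`galoisClosure`) and the action of `G = Gal(E^c/ℚ)` on `Hom(E, ℂ)` and on `𝒫(Hom(E, ℂ))` (`galAct`,
  `galActSet`);
* §2.3 / §3.1 (art. p. 8–11): `H¹(A, ℂ) = ℂ^S`, `S = Φ ⊔ Φ̄` (`VC`), its rational structure `H¹(A, ℚ) = E`
  (`ratVec`), `H^r(A, ℂ) = ⋀^r ℂ^S` (`Hr`), the wedges `[P] = ⋀_{φ ∈ P} φ` (`wedge`), `H^r(A, ℚ) = ⋀^r_ℚ H¹(A, ℚ)`
  (`ratStr`), `H^{p,p}(A, ℂ)` (`Hpp`), `B^p(A) = H^{p,p}(A, ℂ) ∩ H^{2p}(A, ℚ)` (`Bp`), condition (3.2) (`SatisfiesEq32`)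
  and the paper's ordering convention on `S` (`OrderConvention`);
* proved API: the hypotheses are non-vacuous (`isCMAlgebra_pi`, `exists_orderConvention`) and the `[P]` form a basis
  of `⋀^r ℂ^S` (`linearIndependent_wedge`, `span_wedge_eq_top`).

Everything is stated for an arbitrary commutative `ℚ`-algebra `E` (finite-dimensional where `Hom(E, ℂ)` must be
finite); the CM hypotheses enter only the theorems.  Relation to the tree's carrier for CM types of a FIELD,
`Literature.AlgebraicGeometry.Motives.CMType E = {Φ : Set (E →+* ℂ) // φ ∈ Φ ↔ φ̄ ∉ Φ}`: `CMTypeOn E` is the same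
shape (`mem_iff`) over `ℚ`-ALGEBRA homomorphisms of a CM ALGEBRA (a finite product of CM fields, as the paper needs
for non-simple `A`), with `Φ` a `Finset`; for a number field the two notions correspond under `RingHom.toRatAlgHom`
(not needed here, not restated).

LOCATORS.  Every quotation gives "art. p. N" = the page of the article's own pagination (table of contents, held chunk
p0001: §2 at p. 6, §3 at p. 10, §4 at p. 13, §5 at p. 15) and "chunk p00MM Lk" = chunk and line of the held published
text `corpus:paper:galaxy-pdf-4667137180` (42 chunks of 3000 characters — NOT pages), the verifiable locator; the
arXiv text `corpus:paper:arxiv-2411.12249` was read as a cross-check (Theorem 3.1 = its chunk p0009 L32–L44).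
Theorem and equation numbers are those of the published version (identical in arXiv v2).

## References

* [GaoUllmo2025] Z. Gao, E. Ullmo, J. Inst. Math. Jussieu 25 (2025) 215–249 — §2.1, §2.3, §3.1 (Theorem 3.1 and
  its proof, art. p. 11).
* [Pohlmann1968] H. Pohlmann, *Algebraic cycles on abelian varieties of complex multiplication type*, Ann. of
  Math. (2) 88 (1968) 161–180, Thm 1 — the original (simple `A`); quoted through [GaoUllmo2025] only.

## Provenance

Staged by the pub-hodgecm formalisation cell (lineage `pub-hodgecm-pohl`, successor of the cited-fact seat
`pub-hodgecm-cf-gaoullmo`) under the LEAN-IN-TREE rule; supersedes §§CMPair, Model, API of the standalone package's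
`HodgeCM/Literature/GaoUllmo.lean` (gate run 24), namespace `HodgeCM.GaoUllmo` ↦
`Literature.AlgebraicGeometry.GaoUllmo2025`, statements unchanged.
-/

noncomputable section

open Module

attribute [local instance] Classical.propDecidable

namespace Literature.AlgebraicGeometry.GaoUllmo2025

/-! ### §2.1 CM algebras, complex embeddings, CM types, the Galois closure `E^c` -/

section CMPair

/-- **CM algebra** (§2.1, art. p. 6, chunk p0007 L1, verbatim): "A number field `E` is called a CM field if it is an
imaginary quadratic extension of a totally real number field. A CM algebra is a finite product of CM fields."
Mathlib's `NumberField.IsCMField K` ("`K` is a totally complex quadratic extension of its maximal real subfield") is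
the same notion of CM field. [cite: GaoUllmo2025, §2.1] -/
def IsCMAlgebra (E : Type) [CommRing E] [Algebra ℚ E] : Prop :=
  ∃ (ι : Type) (_ : Fintype ι) (K : ι → Type) (_ : ∀ i, Field (K i)) (_ : ∀ i, NumberField (K i)),
    (∀ i, NumberField.IsCMField (K i)) ∧ Nonempty (E ≃ₐ[ℚ] ((i : ι) → K i))

variable (E : Type) [CommRing E] [Algebra ℚ E]

/-- `Hom(E, ℂ)`: the `ℚ`-algebra homomorphisms `E → ℂ` (§2.1, art. p. 7, chunk p0007 L7: "the Galois group
`G := Gal(E^c/ℚ)` acts on `Hom(E, ℂ) = Φ ⊔ Φ̄`"; §3.1: "`S = Φ ⊔ Φ̄`"). [cite: GaoUllmo2025, §2.1] -/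
abbrev Emb : Type := E →ₐ[ℚ] ℂ

/-- Complex conjugation as a `ℚ`-algebra endomorphism of `ℂ`. [folklore] -/
def conjC : ℂ →ₐ[ℚ] ℂ := (starRingEnd ℂ).toRatAlgHom

/-- `conjC` is complex conjugation. [folklore] -/
@[simp] theorem conjC_apply (z : ℂ) : conjC z = starRingEnd ℂ z := rfl

variable {E}

/-- The complex conjugate `φ̄ = c ∘ φ` of an embedding (§2.1, chunk p0007 L1: "`Φ̄ = {φ̄₁, …, φ̄_g}` is the complex
conjugate of `Φ`"). [cite: GaoUllmo2025, §2.1] -/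
def conjEmb (φ : Emb E) : Emb E := conjC.comp φ

/-- `φ̄(a) = conj(φ(a))`. [folklore] -/
@[simp] theorem conjEmb_apply (φ : Emb E) (a : E) : conjEmb φ a = starRingEnd ℂ (φ a) := rfl

/-- `φ ↦ φ̄` is an involution. [folklore] -/
@[simp] theorem conjEmb_conjEmb (φ : Emb E) : conjEmb (conjEmb φ) = φ := by
  ext a; simp

variable (E)

/-- **CM type** (§2.1, art. p. 6, chunk p0007 L1–L3, verbatim): "A CM type on a CM algebra `E` is a subset
`Φ = {φ₁, …, φ_g} ⊆ Hom(E, ℂ)` such that `Hom(E, ℂ) = Φ ⊔ Φ̄` (where `Φ̄ = {φ̄₁, …, φ̄_g}` is the complex conjugate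
of `Φ`). A CM pair is a pair `(E, Φ)` consisting of a CM algebra `E` and a CM type `Φ`."  The disjoint-union condition
is recorded as `φ ∈ Φ ↔ φ̄ ∉ Φ` for every `φ` (for the involution `φ ↦ φ̄` this is equivalent to `Hom(E, ℂ) = Φ ⊔ Φ̄`;
same shape as the tree's `Literature.AlgebraicGeometry.Motives.CMType` for fields). [cite: GaoUllmo2025, §2.1] -/
structure CMTypeOn where
  /-- the set `Φ ⊆ Hom(E, ℂ)` -/
  Φ : Finset (Emb E)
  /-- `Hom(E, ℂ) = Φ ⊔ Φ̄` -/
  mem_iff : ∀ φ : Emb E, φ ∈ Φ ↔ conjEmb φ ∉ Φ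

variable {E}

/-- `Φ̄`, the complex conjugate of `Φ` (a `Finset`). [cite: GaoUllmo2025, §2.1] -/
def CMTypeOn.bar (Φ : CMTypeOn E) : Finset (Emb E) := Φ.Φ.image conjEmb

/-- `Φ̄` is the complement of `Φ` in `Hom(E, ℂ)` ("`Hom(E, ℂ) = Φ ⊔ Φ̄`"). [cite: GaoUllmo2025, §2.1] -/
theorem CMTypeOn.mem_bar_iff (Φ : CMTypeOn E) (φ : Emb E) : φ ∈ Φ.bar ↔ φ ∉ Φ.Φ := by
  classical
  unfold CMTypeOn.bar
  constructor
  · rintro h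
    obtain ⟨ψ, hψ, rfl⟩ := Finset.mem_image.mp h
    exact (Φ.mem_iff ψ).mp hψ
  · intro h
    refine Finset.mem_image.mpr ⟨conjEmb φ, ?_, conjEmb_conjEmb φ⟩
    rw [Φ.mem_iff, conjEmb_conjEmb]
    exact h

variable (E)

/-- **The Galois closure `E^c ⊂ ℂ`** (§2.1, art. p. 6–7, chunk p0007 L7, verbatim): "the Galois closure `E^c` of a
CM algebra `E` is defined as follows: `E = E₁^{n₁} × ⋯ × E_m^{n_m}` with each `E_j` a CM field, and `E^c` is defined
to be the composite of the Galois closures of `E₁, …, E_m` in `ℚ̄`" (`ℚ̄` = the algebraic closure of `ℚ` in `ℂ`,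
§1).  The Galois closure of `E_j` in `ℚ̄` is the composite of the images of all complex embeddings of `E_j`, and every
`φ ∈ Hom(E, ℂ)` factors through a projection `E → E_j`, so `E^c` is the subfield of `ℂ` generated by
`⋃_{φ ∈ Hom(E,ℂ)} φ(E)` — the definition taken here (meaningful for any `ℚ`-algebra `E`).
[cite: GaoUllmo2025, §2.1] -/
def galoisClosure : IntermediateField ℚ ℂ :=
  IntermediateField.adjoin ℚ (⋃ φ : Emb E, Set.range φ)

/-- Every embedding lands in `E^c`. [folklore] -/
theorem range_subset_galoisClosure (φ : Emb E) : Set.range φ ⊆ (galoisClosure E : Set ℂ) := fun _ hz =>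
  IntermediateField.subset_adjoin ℚ _ (Set.mem_iUnion.mpr ⟨φ, hz⟩)

/-- An embedding `φ : E → ℂ` corestricted to `E^c` (`Hom(E, ℂ) = Hom(E, E^c)`). [folklore] -/
def corestrict (φ : Emb E) : E →ₐ[ℚ] galoisClosure E :=
  AlgHom.codRestrict φ (galoisClosure E).toSubalgebra
    (fun a => range_subset_galoisClosure E φ (Set.mem_range_self a))

/-- `corestrict` does not change values. [folklore] -/
@[simp] theorem coe_corestrict_apply (φ : Emb E) (a : E) : (corestrict E φ a : ℂ) = φ a := rfl

/-- **The action of `G = Gal(E^c/ℚ)` on `Hom(E, ℂ)`** (§2.1, art. p. 7, chunk p0007 L7, verbatim): "Then the Galois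
group `G := Gal(E^c/ℚ)` acts on `Hom(E, ℂ) = Φ ⊔ Φ̄`" — by post-composition, `σ · φ = σ ∘ φ`, reading `φ` as a map
into `E^c`. [cite: GaoUllmo2025, §2.1] -/
def galAct (σ : galoisClosure E ≃ₐ[ℚ] galoisClosure E) (φ : Emb E) : Emb E :=
  ((galoisClosure E).val.comp (σ : galoisClosure E →ₐ[ℚ] galoisClosure E)).comp (corestrict E φ)

/-- `(σ · φ)(a) = σ(φ(a))`. [folklore] -/
@[simp] theorem galAct_apply (σ : galoisClosure E ≃ₐ[ℚ] galoisClosure E) (φ : Emb E) (a : E) :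
    galAct E σ φ a = (σ (corestrict E φ a) : ℂ) := rfl

/-- The induced action of `G` on `𝒫(S)` (§3.1, art. p. 11, chunk p0012 L1: "Finally, the Galois group
`G = Gal(E^c/ℚ)` operates on `𝒫(S)`"). [cite: GaoUllmo2025, §3.1] -/
def galActSet (σ : galoisClosure E ≃ₐ[ℚ] galoisClosure E) (P : Finset (Emb E)) : Finset (Emb E) :=
  P.image (galAct E σ)

end CMPair

/-! ### §2.3 and §3.1: the cohomology of `A` — `H¹(A, ℂ) = ℂ^S`, `H^r(A, ℂ) = ⋀^r ℂ^S`, `[P]`, `H^{p,p}`, `B^p(A)` -/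

section Model

variable (E : Type) [CommRing E] [Algebra ℚ E]

/-- `ℂ^S`, `S = Hom(E, ℂ)` (§3.1, chunk p0011 L25: "We have an isomorphism `H^r(A, ℂ) = ⋀^r ℂ^S`"; for `r = 1` this
is §2.3 eq. (2.2), `V_ℂ = ⊕_{φ ∈ Φ} V_{ℂ,φ} ⊕ ⊕_{φ ∈ Φ} V_{ℂ,φ̄}`, the decomposition of `V_ℂ = H¹(A, ℂ)` into the
eigenlines of `E^×`: "`E^×` can be identified with the diagonal torus of `GL(V_ℂ)`", chunk p0008 L13).
[cite: GaoUllmo2025, §2.3] -/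
abbrev VC : Type := Emb E → ℂ

/-- **The rational structure on `H¹`** (§2.3, art. p. 8–9, chunk p0008 L5–L13): `V = H¹(A, ℚ)` is a `ℚ`-vector space
of dimension `2g` on which `E` acts, "the action of `E` on `V` makes `V` into a one dimensional `E`-vector space"
(simple case) and in general "`X^*(E^×) = ⊕_{φ ∈ Φ} ℤφ ⊕ ⊕_{φ ∈ Φ} ℤφ̄`" with `V_ℂ` the sum of the corresponding
eigenspaces (eq. (2.2)); for `A` associated with `(E, Φ)`, i.e. isogenous to `ℂ^g/Φ(𝓞_E)` (§2.1), `H₁(A, ℚ) ≅ E` and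
`V ≅ E^∨ ≅ E` as `E`-modules (trace form of an étale algebra).  With `V = E`, the vector `a ∈ E = H¹(A, ℚ)` has
coordinates `(φ(a))_{φ ∈ S}` in the eigenbasis of `V_ℂ = E ⊗_ℚ ℂ ≅ ℂ^S`; this map `H¹(A, ℚ) → H¹(A, ℂ) = ℂ^S` is
`ratVec`.  It is `E`-equivariant for `E` acting on the `φ`-th coordinate through `φ` (the "diagonal torus").
[cite: GaoUllmo2025, §2.3] -/
def ratVec : E →ₗ[ℚ] VC E where
  toFun a := fun φ => φ a
  map_add' a b := by ext φ; simp
  map_smul' q a := by ext φ; simp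

/-- The `φ`-coordinate of `ratVec a` is `φ(a)`. [folklore] -/
@[simp] theorem ratVec_apply (a : E) (φ : Emb E) : ratVec E a φ = φ a := rfl

/-- `ratVec` is `E`-equivariant for the diagonal action. [folklore] -/
theorem ratVec_mul (a b : E) : ratVec E (a * b) = fun φ => φ a * ratVec E b φ := by
  ext φ; simp

variable [Module.Finite ℚ E]

/-- The standard basis vector `φ ∈ ℂ^S` (§3.1 writes the generator of the eigenline `V_{ℂ,φ}` simply as `φ`:
"`H^{1,0}(A, ℂ) = Σ_{φ ∈ Φ} ℂφ`", chunk p0011 L27).  (`Hom(E, ℂ)` is finite because `E` is finite-dimensional.)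
[cite: GaoUllmo2025, §3.1] -/
def e (φ : Emb E) : VC E := Pi.basisFun ℂ (Emb E) φ

/-- `H^r(A, ℂ) = ⋀^r ℂ^S` (§3.1, art. p. 10–11, chunk p0011 L25, verbatim: "We have an isomorphism
`H^r(A, ℂ) = ⋀^r ℂ^S`"). [cite: GaoUllmo2025, §3.1] -/
abbrev Hr (r : ℕ) : Type := ⋀[ℂ]^r (VC E)

/-- **`[P] := ⋀_{φ ∈ P} φ`** for `P ∈ 𝒫(S)` with `|P| = r` (§3.1, art. p. 11, chunk p0011 L29–L31, verbatim: "Fix an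
ordering on `S` … Let `𝒫(S)` be the set of subsets of `S`. For each subset `P ∈ 𝒫(S)`, let `[P] := ⋀_{φ ∈ P} φ`."),
the wedge being taken in the increasing order of `S`; this is Mathlib's basis `(Pi.basisFun ℂ S).exteriorPower r` of
`⋀^r ℂ^S` indexed by `Set.powersetCard S r = {P ⊆ S | |P| = r}`. [cite: GaoUllmo2025, §3.1] -/
def wedge [LinearOrder (Emb E)] (r : ℕ) (P : Set.powersetCard (Emb E) r) : Hr E r :=
  (Pi.basisFun ℂ (Emb E)).exteriorPower r P

/-- **The rational structure `H^r(A, ℚ) ⊂ H^r(A, ℂ)`**: `H^r(A, ℚ) = ⋀^r_ℚ H¹(A, ℚ)`, i.e. the `ℚ`-span of the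
wedges `v₁ ∧ ⋯ ∧ v_r` of rational vectors `v_i ∈ H¹(A, ℚ) = E` inside `⋀^r_ℂ ℂ^S` (§3.1 uses
`H^{2p}(A, ℚ) ⊂ H^{2p}(A, ℂ) = ⋀^{2p} ℂ^S` in "`B^p(A) := H^{p,p}(A, ℂ) ∩ H^{2p}(A, ℚ)`", chunk p0011 L21; that the
cohomology ring of the complex torus `A` is the exterior algebra on `H¹` over `ℚ` is the content of
"`H^r(A, ℂ) = ⋀^r ℂ^S`" read over `ℚ`). [cite: GaoUllmo2025, §3.1] -/
def ratStr (r : ℕ) : Submodule ℚ (Hr E r) :=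
  Submodule.span ℚ (Set.range fun a : Fin r → E => exteriorPower.ιMulti ℂ r (fun i => ratVec E (a i)))

variable {E}

/-- **`H^{p,p}(A, ℂ)`** (§3.1, art. p. 11, chunks p0011 L31–p0012 L1, verbatim: "Then the component
`H^{p,q}(A, ℂ) = ⋀^p H^{1,0}(A, ℂ) ⊗ ⋀^q H^{0,1}(A, ℂ)` of the Hodge decomposition has a basis consisting of the `[P]`
such that `|P ∩ Φ| = p` and `|P ∩ Φ̄| = q` for `P` an ordered subset of `S`", where "`H^{1,0}(A, ℂ) = Σ_{φ ∈ Φ} ℂφ`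
and `H^{0,1}(A, ℂ) = Σ_{φ' ∈ Φ̄} ℂφ'`").  Only the piece `p = q` in degree `2p` is needed for `B^p`.
[cite: GaoUllmo2025, §3.1] -/
def Hpp [LinearOrder (Emb E)] (Φ : CMTypeOn E) (p : ℕ) : Submodule ℂ (Hr E (2 * p)) :=
  Submodule.span ℂ {x | ∃ P : Set.powersetCard (Emb E) (2 * p),
    ((P : Finset (Emb E)) ∩ Φ.Φ).card = p ∧ ((P : Finset (Emb E)) ∩ Φ.bar).card = p ∧ x = wedge E (2 * p) P}

/-- **`B^p(A) := H^{p,p}(A, ℂ) ∩ H^{2p}(A, ℚ)`**, "the `ℚ`-vector space of `ℚ`-Hodge cycles of type `(p,p)` on `A`"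
(§3.1, art. p. 10, chunk p0011 L21, verbatim). [cite: GaoUllmo2025, §3.1] -/
def Bp [LinearOrder (Emb E)] (Φ : CMTypeOn E) (p : ℕ) : Submodule ℚ (Hr E (2 * p)) :=
  ratStr E (2 * p) ⊓ (Hpp Φ p).restrictScalars ℚ

/-- **Condition (3.2)** on `P ∈ 𝒫(S)` (Theorem 3.1, chunk p0012 L5, verbatim): "`|σP ∩ Φ| = |σP ∩ Φ̄|` for all
`σ ∈ G`" (`G = Gal(E^c/ℚ)` acting on `𝒫(S)` through its action on `S = Hom(E, ℂ)`). [cite: GaoUllmo2025, Thm 3.1] -/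
def SatisfiesEq32 (Φ : CMTypeOn E) (P : Finset (Emb E)) : Prop :=
  ∀ σ : galoisClosure E ≃ₐ[ℚ] galoisClosure E,
    (galActSet E σ P ∩ Φ.Φ).card = (galActSet E σ P ∩ Φ.bar).card

/-- The paper's ordering convention on `S` (§3.1, chunk p0011 L29, verbatim: "Fix an ordering on `S` such that
`φ ≤ φ'` for each `φ ∈ Φ` and `φ' ∈ Φ̄`"). [cite: GaoUllmo2025, §3.1] -/
def OrderConvention [LinearOrder (Emb E)] (Φ : CMTypeOn E) : Prop :=
  ∀ φ ∈ Φ.Φ, ∀ φ' ∈ Φ.bar, φ ≤ φ'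

end Model

/-! ### API (proved): non-vacuity of the hypotheses; the `[P]` form a basis of `⋀^r ℂ^S` -/

section API

/-- A finite product of CM fields is a CM algebra in the sense of `IsCMAlgebra` (by `AlgEquiv.refl`); in particular
`E = F^{n+1}` for a CM field `F` (the CM algebra of a product `∏_{j ≤ n} A_{(F, Θ_j)}` of `n+1` abelian varieties with
CM by the same CM field `F` — §2.1 "`E = E₁^{n₁} × ⋯ × E_m^{n_m}`" with `m = 1`) is one. [folklore] -/
theorem isCMAlgebra_pi (ι : Type) [Fintype ι] (K : Type) [Field K] [NumberField K] [NumberField.IsCMField K] :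
    IsCMAlgebra (ι → K) :=
  ⟨ι, inferInstance, fun _ => K, inferInstance, inferInstance, fun _ => inferInstance, ⟨AlgEquiv.refl⟩⟩

variable {E : Type} [CommRing E] [Algebra ℚ E] [Module.Finite ℚ E]

/-- The paper's ordering convention can always be met: there is a linear order on `S = Hom(E, ℂ)` with `Φ` before
`Φ̄`. [folklore] -/
theorem exists_orderConvention (Φ : CMTypeOn E) :
    ∃ r : LinearOrder (Emb E), @OrderConvention E _ _ r Φ := by
  classical
  obtain ⟨N, ⟨g⟩⟩ := Finite.exists_equiv_fin (Emb E)
  let key : Emb E → Bool ×ₗ Fin N := fun φ => toLex (decide (φ ∉ Φ.Φ), g φ)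
  have hkey : Function.Injective key := by
    intro φ ψ h
    have h2 := congrArg (fun x => (ofLex x).2) h
    exact g.injective (by simpa [key] using h2)
  refine ⟨LinearOrder.lift' key hkey, ?_⟩
  intro φ hφ φ' hφ'
  rw [CMTypeOn.mem_bar_iff] at hφ'
  show key φ ≤ key φ'
  apply le_of_lt
  simp only [key, Prod.Lex.toLex_lt_toLex]
  left
  simp [hφ, hφ']

/-- The vectors `[P]`, `P ∈ 𝒫(S)`, `|P| = r`, are linearly independent in `⋀^r ℂ^S` (they form a basis).
[folklore] -/
theorem linearIndependent_wedge [LinearOrder (Emb E)] (r : ℕ) :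
    LinearIndependent ℂ (wedge E r) :=
  ((Pi.basisFun ℂ (Emb E)).exteriorPower r).linearIndependent

/-- The `[P]` span `⋀^r ℂ^S`. [folklore] -/
theorem span_wedge_eq_top [LinearOrder (Emb E)] (r : ℕ) :
    Submodule.span ℂ (Set.range (wedge E r)) = ⊤ :=
  ((Pi.basisFun ℂ (Emb E)).exteriorPower r).span_eq

end API

end Literature.AlgebraicGeometry.GaoUllmo2025

end
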